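import Literature.MathematicalPhysics.QuantumFieldTheory.Balaban1983to89.Beta.RemainderDecay190
import Literature.MathematicalPhysics.QuantumFieldTheory.Balaban1983to89.Beta.RemainderLocalitySockets

/-!
# [Balaban1987RG1] (1.21) p. 264 on the (4.4)-space MODEL: the test-vector limit `hconv` of the (190)-socket read
# ENTRYWISE — restricted kernel columns of δ𝐇_j∕δB that are periodisations of decaying ℤ^d kernels converge
# (`Beta.RemainderDecay190SupNormLimit`)

statement-level skeleton of published theorems with citation tags; proofs where landed; nothing here is a claim
about the Yang–Mills mass gap.

HONEST FRAMING (cell rule).  Bookkeeping for the k-uniform remainder chain of row (D4) (`RemainderConst` ⇐ ONE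
`ChainTFac190` instance, `Beta.RemainderDecay190`); discharges NOTHING of `BetaPertH`; NOT B12 Thm 2, NOT the continuum
limit, NOT Clay.  Unit `b2b-balaban-beta-an4` gen 94 (BINDER row D4 OWNER; cell pub-balaban).  Imports
`Beta.RemainderDecay190` and `Beta.RemainderLocalitySockets` ONLY; nothing edited.

WHAT.  With the (4.4)-space MODEL of `Beta.RemainderDecay190SupNorm` (this generation) — `Wn n := TPt d (N n·M) → ℂ`
with the sup norm, a real configuration read by restriction to the cubes of X̄ — the (190)-socket's (4.35) test vector
is `D.hn n X̄ x = (x′ ↦ cube x′ ∈ X̄ ? ((δ𝐇∕δB)_n(δ_x)(x′) : ℂ) : 0)` (the computation rule exposed by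
`exists_data190_of_sectG_blocks_supNorm`; here the HYPOTHESIS `hrule` on an arbitrary socket `D` over that `Wn`).  The
leaf lists of row (D4) consume the test vectors through NODE E's field `hconv` ([I] (1.21) p. 264: *"T^{(j+1)} ↗ ℤ^d …
This limit exists by the localized representation (1.7)"*): `r n Y (D.hn n (tproj Y) [x]) → t Y x` for restriction maps
`r n Y : Wn n →L[ℂ] V Y`.  ON THE MODEL the natural instruments are the cell's own (F2)-socket ones
(`Beta.RemainderLocalitySockets`, generation 11 of this lineage): `V Y := ι Y → ℂ`, `r n Y := restrictCLM (N n·M) (e Y)`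
(read-out at finitely many lattice sites `e Y i` INSIDE the cubes of Y), no identification map.  THIS FILE proves:
* §1 `restrictCLM_restrictC` — reading the restriction-to-X̄ of a configuration at window sites inside the cubes of
  `Y` returns the configuration's values there (the indicator is 1: `tcubeOf_proj_mem_tproj`).
* §2 **`hconv_restrictCLM_of_periodised`** — THE (1.21) FIELD ON THE MODEL FROM AN ENTRYWISE KERNEL STATEMENT: if the
  kernel entries of `(δ𝐇∕δB)_n` between a source site `[x]` and the window sites `[e Y i]` are the entries of the
  two-variable PERIODISATION `Ŝ_Y` of a ℤ^d kernel `S_Y` that is jointly `N n·M`-periodic and decays exponentially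
  ([I] (5.10) p. 293 shape; [Balaban1984PropagatorsI] p. 36 *"relating G on the torus to G on the whole lattice in the
  usual way"*), and `N n → ∞`, then `restrictCLM (N n·M) (e Y) (D.hn n (tproj Y) [x]) → (S_Y(e Y i, x))_i` — by the
  engine `RemainderLocalitySockets.hconv_periodise₂_cubes` (entrywise volume limit) and §1.  This is the model twin of
  the gaps cell's abstract junction `Gaps.D4NodeEConvergence.hconv_of_periodisedColumns` (there: any `Wn`, an
  identification `Φ Y` and the hypothesis `hid`; here: `Φ = id` and `hid` REDUCED to the entrywise identity `hker`).
BUILDER STILL SUPPLIES (NODE O ∕ E): the ℤ^d kernels `S_Y`, their joint periodicity and decay, and the entrywise identity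
`hker` for Bałaban's δ𝐇_j∕δB — nothing of it is asserted here.  Row D4 class UNCHANGED (instance 0∕1; critical-path
width 0 = NODE O; D4 DISCHARGE NO DATE).  No `def`, no named fact, no `sorry`, standard axioms.
HONEST DEPENDENCY: continuum YM on T⁴ ⇐ BetaPertH ∧ nine spine estimates (0/9 proved); BetaPertH ⇐ (D1) ∧ (D4) ∧
CAP+tail; G-an2-4 gates asym, D1 and NE2/3/4.

Sources: [I] = T. Bałaban, *Renormalization group approach to lattice gauge field theories. I*, Commun. Math. Phys.
**109** (1987) 249–301 [Balaban1987RG1], (1.21) p. 264, (4.35) p. 290, (5.10) p. 293; T. Bałaban, *Propagators and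
renormalization transformations for lattice gauge theories. I*, Commun. Math. Phys. **95** (1984) 17–40
[Balaban1984PropagatorsI], p. 36.
-/

namespace Literature.MathematicalPhysics.QuantumFieldTheory.Balaban1983to89.Beta.RemainderDecay190SupNormLimit

open Literature.MathematicalPhysics.QuantumFieldTheory.Balaban1983to89
open Literature.MathematicalPhysics.QuantumFieldTheory.Balaban1983to89.B13ScaleTransfer (Pt)
open Literature.MathematicalPhysics.QuantumFieldTheory.Balaban1983to89.TreeLengthTorus (TPt TDom proj)
open Literature.MathematicalPhysics.QuantumFieldTheory.Balaban1983to89.B12Decay510Lattice (cubeOf)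
open Literature.MathematicalPhysics.QuantumFieldTheory.Balaban1983to89.B12Decay510Torus (tcubeOf proj_cubeOf_of_proj_eq)
open Literature.MathematicalPhysics.QuantumFieldTheory.Balaban1983to89.Beta.RemainderLimitTorus (LDom tproj tproj_val)
open Literature.MathematicalPhysics.QuantumFieldTheory.Balaban1983to89.Beta.RemainderDecay190 (Data190 Consts190)
open Literature.MathematicalPhysics.QuantumFieldTheory.Balaban1983to89.Beta (Kernel₂ IsPeriodic₂ Decay₂ periodise₂)
open Literature.MathematicalPhysics.QuantumFieldTheory.Balaban1983to89.Beta.RemainderLocalitySockets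
  (restrictCLM restrictCLM_apply hconv_periodise₂_cubes)
open Filter Topology

variable {d M : ℕ} [NeZero M]

/-! ## 1. Reading the restriction-to-X̄ at window sites inside the cubes of the domain -/

/-- The cube of the residue of a lattice site `y` is the residue of its cube: if `⌊y∕M⌋ ∈ Y` then
`cube [y] ∈ tproj N Y` (elementary; locus = the cubes of side M of the torus). [cite: Balaban1987RG1, §0 p.257] -/
theorem tcubeOf_proj_mem_tproj {N : ℕ} [NeZero N] (Y : LDom d) {y : Pt d} (hy : cubeOf M y ∈ Y.1) :
    tcubeOf N M (proj (N * M) y) ∈ (tproj N Y).1 := by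
  rw [tproj_val, ← proj_cubeOf_of_proj_eq (N := N) (M := M) (P := y) rfl]
  exact Finset.mem_image_of_mem _ hy

/-- **Window read-out of the model identification**: for window sites `e i` INSIDE the cubes of `Y`, reading the
restriction of a configuration `A` to the cubes of `tproj N Y` (complexified) at the residues `[e i]` returns the values
`A [e i]`. [cite: Balaban1987RG1, (4.4) p.281, (1.21) p.264] -/
theorem restrictCLM_restrictC {N : ℕ} [NeZero N] (Y : LDom d) {ι : Type*} (e : ι → Pt d)
    (he : ∀ i, cubeOf M (e i) ∈ Y.1) (A : TPt d (N * M) → ℝ) :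
    restrictCLM (N * M) e
        (fun x' : TPt d (N * M) => if tcubeOf N M x' ∈ (tproj N Y).1 then ((A x' : ℝ) : ℂ) else 0) =
      fun i => ((A (proj (N * M) (e i)) : ℝ) : ℂ) := by
  funext i
  rw [restrictCLM_apply, if_pos (tcubeOf_proj_mem_tproj Y (he i))]

/-! ## 2. The (1.21) field of the leaf lists on the model, from an entrywise kernel statement -/

/-- **[I] (1.21) ON THE (4.4)-SPACE MODEL, FROM AN ENTRYWISE KERNEL STATEMENT.**  Let `D` be a (190)-socket over
`Wn n := TPt d (N n·M) → ℂ` whose (4.35) test vector is the restricted kernel column of `dH n` (`hrule` — the computation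
rule of `RemainderDecay190SupNorm.exists_data190_of_sectG_blocks_supNorm`).  Suppose that for every ℤ^d localization
domain `Y` there is a ℤ^d kernel `S Y`, jointly `N n·M`-periodic for every n (`hS`) and exponentially decaying (`hdec`,
`δ > 0`), such that the kernel entries of `dH n` between the source site `[x]` and the window sites `[e Y i]`
(finitely many lattice sites inside the cubes of `Y`, `he`) are the entries of its periodisation (`hker`); and
`N n → ∞`.  Then the restricted test vectors converge: `restrictCLM (N n·M) (e Y) (D.hn n (tproj Y) [x]) →
(S Y (e Y i) x)_i` — the field `hconv` of `PolLeavesTFac190` with `V Y := ι Y → ℂ`, `r n Y := restrictCLM (N n·M) (e Y)`,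
`t Y x := (S Y (e Y i, x))_i`. [cite: Balaban1987RG1, (1.21) p.264, (5.10) p.293; Balaban1984PropagatorsI, p.36] -/
theorem hconv_restrictCLM_of_periodised {N : ℕ → ℕ} [∀ n, NeZero (N n)] {q : Consts190}
    (D : Data190 d M N (fun n => TPt d (N n * M) → ℂ) q)
    (dH : (n : ℕ) → (TPt d (N n * M) → ℝ) →ₗ[ℝ] (TPt d (N n * M) → ℝ))
    (hrule : ∀ (n : ℕ) (X : TDom d (N n)) (x : TPt d (N n * M)),
      D.hn n X x = fun x' : TPt d (N n * M) =>
        if tcubeOf (N n) M x' ∈ X.1 then ((dH n (Pi.single x (1 : ℝ)) x' : ℝ) : ℂ) else 0)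
    (hN : Tendsto N atTop atTop) {S : LDom d → Kernel₂ d} {C δ : ℝ}
    (hS : ∀ Y n, IsPeriodic₂ (N n * M) (S Y)) (hdec : ∀ Y, Decay₂ (S Y) C δ) (hδ : 0 < δ)
    {ι : LDom d → Type} [∀ Y, Fintype (ι Y)] (e : (Y : LDom d) → ι Y → Pt d)
    (he : ∀ Y i, cubeOf M (e Y i) ∈ Y.1)
    (hker : ∀ (Y : LDom d) (n : ℕ) (i : ι Y) (x : Pt d),
      dH n (Pi.single (proj (N n * M) x) (1 : ℝ)) (proj (N n * M) (e Y i)) =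
        periodise₂ (N n * M) (S Y) (proj (N n * M) (e Y i)) (proj (N n * M) x)) :
    ∀ (Y : LDom d) (x : Pt d),
      Tendsto (fun n => restrictCLM (N n * M) (e Y) (D.hn n (tproj (N n) Y) (proj (N n * M) x))) atTop
        (𝓝 fun i => (S Y (e Y i) x : ℂ)) := by
  intro Y x
  refine (hconv_periodise₂_cubes (hS Y) (hdec Y) hδ hN (e Y) x).congr fun n => ?_
  rw [hrule, restrictCLM_restrictC Y (e Y) (he Y)]
  funext i
  rw [restrictCLM_apply, hker]

end Literature.MathematicalPhysics.QuantumFieldTheory.Balaban1983to89.Beta.RemainderDecay190SupNormLimit
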